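import HarnessLib
import Summits.RiemannHypothesis.RiemannHypothesis.Theorems.SignConePointwiseIdentity
import Summits.RiemannHypothesis.RiemannHypothesis.Theorems.SignConeUnitSlackReduction

/-!
# `OscSingleWindow` (crux stmt-RiemannHypothesis-18012): an ERASURE CERTIFICATE proves the crux at its window

Route `SignCone`, crux `Summit.RiemannHypothesis.RiemannHypothesis.Theses.SignCone.OscSingleWindow`
(the unit-slack sign-cone inequality for node-nonnegative `F = Σᵢ gᵢ ⋆ g̃ᵢ` whose far-field
negativity `{log 2 ≤ |t|, Re F(t) < 0}` sits in ONE window `T ≤ |t| ≤ T + log 2`). This file is the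
analytic reduction of crux idea `erasure-unit-comb-certificate` (`CertificateSuffices` of
`Cruxes/OscSingleWindow/SketchIdeator1.lean`), in the vocabulary of the landed pointwise-certificate
files (`SignConePointwiseIdentity.lean`):

* `re_weilPolarTerm_eq_spectral_add_erasure` — for ANY continuous compactly supported real kernel
  `E`, `Re (Ĝ(0) + Ĝ(1)) = (1/2π) ∫ |ĝ(1/2+iy)|² Ê(y) dy + ∫ Re G(x) (e^{x/2} + e^{-x/2} − E(x)) dx`
  (`G = g ⋆ g̃`; Parseval with an `L¹` kernel plus the ERASED remainder — no condition tying `E` to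
  the support of `g`, so the cutoff `a` never enters);
* `slackFunctional_erasure_eq_spectralIntegral` — the slack functional with the erased remainder
  subtracted is the spectral integral of `|ĝ|²` against the density
  `F(y) = Re ψ(1/4+iy/2) − log π + s + Ê(y) − Σ_n a_n cos(y log n)`;
* `neg_re_apply_zero_le_re_weilArchPolar_of_erasure` — if `E ≤ e^{x/2} + e^{-x/2}` everywhere,
  `E = e^{x/2} + e^{-x/2}` on the near field `|x| < log 2` and on the window `T ≤ |x| ≤ T + log 2`,
  the nodes are `≥ 2` with weights `a_n ≥ 0`, and the density (slack `s = 1`) is pointwise `≥ 0`,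
  then `-Re F(0) ≤ Re W_ar(F)` for every node-nonnegative `F = Σᵢ gᵢ ⋆ g̃ᵢ` whose far-field
  negativity lies in the window (sum the identities over `i`; the node terms are `≥ 0` by the node
  signs, the erased remainder `∫ Re F · (2cosh(x/2) − E) ≥ 0` by the far-field sign off the window);
* `oscSingleWindowAt_of_erasure` — the crux AT THE WINDOW `T`, body verbatim over Mathlib
  primitives (all cutoffs `a`), from such a certificate.

No number theory and no computation here; the certificates themselves are separate files.
-/

noncomputable section

-- `Summit.RiemannHypothesis.RiemannHypothesis.…` repeats a namespace component by design (D-0017 layout).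
set_option linter.dupNamespace false

open scoped BigOperators ComplexConjugate Real Topology
open Complex MeasureTheory Set Filter

namespace Summit.RiemannHypothesis.RiemannHypothesis.Theorems.SignCone

open Literature.NumberTheory.LFunctions
open Literature.Analysis.SpecialFunctions (reDigammaQuarter)
open Summit.RiemannHypothesis.RiemannHypothesis.Theorems.SignConeOscillatory

section PerTest

variable {g : ℝ → ℂ} (hg : IsWeilTest g) {E : ℝ → ℝ} (hEc : Continuous E) (hEs : HasCompactSupport E)
include hg hEc hEs

/-- **The polar term with an arbitrary kernel.** For `G = g ⋆ g̃` and any continuous compactly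
supported real `E`:
`Re (Ĝ(0) + Ĝ(1)) = (1/2π) ∫ |ĝ(1/2+iy)|² Ê(y) dy + ∫ Re G(x) · (e^{x/2} + e^{-x/2} − E(x)) dx`. [folklore] -/
theorem re_weilPolarTerm_eq_spectral_add_erasure :
    (weilPolarTerm (weilConv g (weilReflect g))).re =
      (1 / (2 * π) * ∫ y : ℝ, ‖weilMellin g (1 / 2 + y * I)‖ ^ 2 * cosTransform E y) +
        ∫ x : ℝ, (weilConv g (weilReflect g) x).re * (Real.exp (x / 2) + Real.exp (-(x / 2)) - E x) := by
  have hk : IsWeilTest (weilConv g (weilReflect g)) := hg.weilConv hg.weilReflect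
  -- `Ĝ(0) + Ĝ(1) = ∫ G · (e^{x/2} + e^{-x/2})`
  have i0 : Integrable fun t : ℝ => weilConv g (weilReflect g) t * cexp ((0 - 1 / 2) * t) :=
    hk.integrable_mul (by fun_prop)
  have i1 : Integrable fun t : ℝ => weilConv g (weilReflect g) t * cexp ((1 - 1 / 2) * t) :=
    hk.integrable_mul (by fun_prop)
  have hpol : weilPolarTerm (weilConv g (weilReflect g)) =
      ∫ t : ℝ, weilConv g (weilReflect g) t * (((Real.exp (t / 2) + Real.exp (-(t / 2)) : ℝ)) : ℂ) := by
    unfold weilPolarTerm weilMellin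
    rw [← integral_add i0 i1]
    congr 1 with t
    have e1 : cexp (((0 : ℂ) - 1 / 2) * (t : ℂ)) = ((Real.exp (-(t / 2)) : ℝ) : ℂ) := by
      rw [Complex.ofReal_exp]; congr 1; push_cast; ring
    have e2 : cexp (((1 : ℂ) - 1 / 2) * (t : ℂ)) = ((Real.exp (t / 2) : ℝ) : ℂ) := by
      rw [Complex.ofReal_exp]; congr 1; push_cast; ring
    rw [e1, e2]
    push_cast
    ring
  -- split the weight `e^{x/2} + e^{-x/2} = E + (e^{x/2} + e^{-x/2} − E)`
  have iE : Integrable fun t : ℝ => weilConv g (weilReflect g) t * (E t : ℂ) :=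
    hk.integrable_mul (continuous_ofReal.comp hEc)
  have iR : Integrable fun t : ℝ =>
      weilConv g (weilReflect g) t * (((Real.exp (t / 2) + Real.exp (-(t / 2)) - E t : ℝ)) : ℂ) :=
    hk.integrable_mul (continuous_ofReal.comp (by fun_prop))
  have hsplit : (∫ t : ℝ, weilConv g (weilReflect g) t * (((Real.exp (t / 2) + Real.exp (-(t / 2)) : ℝ)) : ℂ)) =
      (∫ t : ℝ, weilConv g (weilReflect g) t * (E t : ℂ)) +
        ∫ t : ℝ, weilConv g (weilReflect g) t * (((Real.exp (t / 2) + Real.exp (-(t / 2)) - E t : ℝ)) : ℂ) := by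
    rw [← integral_add iE iR]
    congr 1 with t
    push_cast
    ring
  have hre : (∫ t : ℝ, weilConv g (weilReflect g) t *
      (((Real.exp (t / 2) + Real.exp (-(t / 2)) - E t : ℝ)) : ℂ)).re =
      ∫ t : ℝ, (weilConv g (weilReflect g) t).re * (Real.exp (t / 2) + Real.exp (-(t / 2)) - E t) := by
    have h := integral_re iR
    simp only [RCLike.re_to_complex] at h
    rw [← h]
    congr 1 with t
    exact Complex.re_mul_ofReal _ _
  rw [hpol, hsplit, Complex.add_re, re_integral_weilConv_weilReflect_mul_eq hg hEc hEs, hre]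

/-- **The slack functional with the erased remainder is a spectral integral.** For `G = g ⋆ g̃`,
real weights `a_n` on a finite set of nodes, a slack `s` and ANY continuous compactly supported
real kernel `E`:
`Re (W_ar(G) − Σ_n (a_n/2)(G(log n)+G(−log n))) + s‖g‖₂² − ∫ Re G · (e^{x/2}+e^{-x/2} − E)`
`= (1/2π) ∫ |ĝ(1/2+iy)|² (Re ψ(1/4+iy/2) − log π + s + Ê(y) − Σ_n a_n cos(y log n)) dy`. [folklore] -/
theorem slackFunctional_erasure_eq_spectralIntegral (s : ℝ) (nodes : Finset ℕ) (a : ℕ → ℝ) :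
    (weilPolarTerm (weilConv g (weilReflect g)) + weilArchTerm (weilConv g (weilReflect g)) -
        ∑ n ∈ nodes, ((a n / 2 : ℝ) : ℂ) *
          (weilConv g (weilReflect g) (Real.log n) + weilConv g (weilReflect g) (-Real.log n))).re +
      s * weilNorm2Sq g -
      ∫ x : ℝ, (weilConv g (weilReflect g) x).re * (Real.exp (x / 2) + Real.exp (-(x / 2)) - E x) =
    1 / (2 * π) * ∫ y : ℝ, ‖weilMellin g (1 / 2 + y * I)‖ ^ 2 *
      (reDigammaQuarter y - Real.log π + s + cosTransform E y -
        ∑ n ∈ nodes, a n * Real.cos (y * Real.log n)) := by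
  set ρ : ℝ → ℝ := fun y => ‖weilMellin g (1 / 2 + y * I)‖ ^ 2 with hρ
  -- the four spectral identities
  have hP := re_weilPolarTerm_eq_spectral_add_erasure hg hEc hEs
  have hA := re_weilArchTerm_weilConv_weilReflect_eq_spectral hg
  have hN : ∀ n ∈ nodes, (((a n / 2 : ℝ) : ℂ) *
      (weilConv g (weilReflect g) (Real.log n) + weilConv g (weilReflect g) (-Real.log n))).re =
      1 / (2 * π) * ∫ y : ℝ, ρ y * (a n * Real.cos (y * Real.log n)) :=
    fun n _ => re_node_eq_spectral hg (a n) (Real.log n)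
  have hPl : weilNorm2Sq g = 1 / (2 * π) * ∫ y : ℝ, ρ y := by
    rw [hρ, integral_norm_sq_weilMellin_half_line hg]
    field_simp
  -- integrability of the pieces
  have iR : Integrable fun y => ρ y * reDigammaQuarter y :=
    integrable_norm_sq_weilMellin_mul_reDigammaQuarter hg
  have i1 : Integrable ρ := integrable_norm_sq_weilMellin_half_line hg
  have iE : Integrable fun y => ρ y * cosTransform E y :=
    integrable_norm_sq_weilMellin_mul hg (continuous_cosTransform hEc hEs).measurable
      (A := ∫ x : ℝ, |E x|) (B := 0) (integral_nonneg fun x => abs_nonneg _) le_rfl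
      fun t => by rw [zero_mul, add_zero]; exact abs_cosTransform_le hEc hEs t
  have iC : ∀ n ∈ nodes, Integrable fun y => ρ y * (a n * Real.cos (y * Real.log n)) := by
    intro n _
    have h := (integrable_norm_sq_weilMellin_mul_two_cos hg (Real.log n)).const_mul (a n / 2)
    refine (integrable_congr (Eventually.of_forall fun y => ?_)).1 h
    simp only [hρ]
    ring
  have iS : Integrable fun y => ρ y * ∑ n ∈ nodes, a n * Real.cos (y * Real.log n) := by
    have : (fun y => ρ y * ∑ n ∈ nodes, a n * Real.cos (y * Real.log n)) =
        fun y => ∑ n ∈ nodes, ρ y * (a n * Real.cos (y * Real.log n)) := by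
      funext y; rw [Finset.mul_sum]
    rw [this]
    exact integrable_finsetSum _ iC
  -- expand the right-hand side
  have eR : (∫ y : ℝ, ρ y *
      (reDigammaQuarter y - Real.log π + s + cosTransform E y -
        ∑ n ∈ nodes, a n * Real.cos (y * Real.log n))) =
      (∫ y, ρ y * reDigammaQuarter y) - Real.log π * (∫ y, ρ y) +
        s * (∫ y, ρ y) + (∫ y, ρ y * cosTransform E y) -
        ∑ n ∈ nodes, ∫ y, ρ y * (a n * Real.cos (y * Real.log n)) := by
    have e1 : (fun y : ℝ => ρ y *
        (reDigammaQuarter y - Real.log π + s + cosTransform E y -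
          ∑ n ∈ nodes, a n * Real.cos (y * Real.log n))) =
        fun y => ρ y * reDigammaQuarter y - Real.log π * ρ y +
          s * ρ y + ρ y * cosTransform E y - ρ y * ∑ n ∈ nodes, a n * Real.cos (y * Real.log n) := by
      funext y; ring
    have j1 : Integrable (fun y => Real.log π * ρ y) := i1.const_mul _
    have j2 : Integrable (fun y => s * ρ y) := i1.const_mul _
    have j3 : Integrable (fun y => ρ y * reDigammaQuarter y - Real.log π * ρ y) := iR.sub j1
    have j4 : Integrable (fun y => ρ y * reDigammaQuarter y - Real.log π * ρ y + s * ρ y) := j3.add j2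
    have j5 : Integrable (fun y => ρ y * reDigammaQuarter y - Real.log π * ρ y + s * ρ y +
        ρ y * cosTransform E y) := j4.add iE
    rw [e1, integral_sub j5 iS, integral_add j4 iE, integral_add j3 j2, integral_sub iR j1,
      integral_const_mul, integral_const_mul]
    congr 1
    rw [← integral_finsetSum _ iC]
    congr 1 with y
    rw [Finset.mul_sum]
  -- expand the left-hand side
  rw [Complex.sub_re, Complex.add_re, Complex.re_sum, hP, hA, Finset.sum_congr rfl hN, hPl, eR,
    ← Finset.mul_sum]
  ring

/-- **Positivity transfer with erasure.** If the density is pointwise non-negative then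
`-s‖g‖₂² ≤ Re (W_ar(G) − Σ_n (a_n/2)(G(log n)+G(−log n))) − ∫ Re G · (e^{x/2}+e^{-x/2} − E)`
for EVERY Weil test `g` (no support condition; `G = g ⋆ g̃`). [folklore] -/
theorem neg_slack_le_sub_erasure_of_density_nonneg (s : ℝ) (nodes : Finset ℕ) (a : ℕ → ℝ)
    (hF : ∀ y : ℝ, 0 ≤ reDigammaQuarter y - Real.log π + s + cosTransform E y -
      ∑ n ∈ nodes, a n * Real.cos (y * Real.log n)) :
    -(s * weilNorm2Sq g) ≤
      (weilPolarTerm (weilConv g (weilReflect g)) + weilArchTerm (weilConv g (weilReflect g)) -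
        ∑ n ∈ nodes, ((a n / 2 : ℝ) : ℂ) *
          (weilConv g (weilReflect g) (Real.log n) + weilConv g (weilReflect g) (-Real.log n))).re -
      ∫ x : ℝ, (weilConv g (weilReflect g) x).re * (Real.exp (x / 2) + Real.exp (-(x / 2)) - E x) := by
  have h := slackFunctional_erasure_eq_spectralIntegral hg hEc hEs s nodes a
  have hpos : 0 ≤ 1 / (2 * π) * ∫ y : ℝ, ‖weilMellin g (1 / 2 + y * I)‖ ^ 2 *
      (reDigammaQuarter y - Real.log π + s + cosTransform E y -
        ∑ n ∈ nodes, a n * Real.cos (y * Real.log n)) :=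
    mul_nonneg (by positivity) (integral_nonneg fun y => mul_nonneg (sq_nonneg _) (hF y))
  linarith

end PerTest

section Class

variable {E : ℝ → ℝ} (hEc : Continuous E) (hEs : HasCompactSupport E)
  (hEle : ∀ x : ℝ, E x ≤ Real.exp (x / 2) + Real.exp (-(x / 2)))
  {T : ℝ}
  (hEeq : ∀ x : ℝ, (|x| < Real.log 2 ∨ (T ≤ |x| ∧ |x| ≤ T + Real.log 2)) →
    E x = Real.exp (x / 2) + Real.exp (-(x / 2)))
  (nodes : Finset ℕ) (hnodes : ∀ n ∈ nodes, 2 ≤ n) (a : ℕ → ℝ) (ha : ∀ n ∈ nodes, 0 ≤ a n)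
  (hD : ∀ y : ℝ, 0 ≤ reDigammaQuarter y - Real.log π + 1 + cosTransform E y -
    ∑ n ∈ nodes, a n * Real.cos (y * Real.log n))
include hEc hEs hEle hEeq hnodes ha hD

/-- **An erasure certificate at the window `T` forces the unit-slack inequality on the single-window
class at `T`.** Kernel `E` (continuous, compact support): `E ≤ e^{x/2} + e^{-x/2}` everywhere, with
equality on the near field `|x| < log 2` and on the window `T ≤ |x| ≤ T + log 2`; weights `a_n ≥ 0`
on nodes `n ≥ 2`; density `Re ψ(1/4+iy/2) − log π + 1 + Ê(y) − Σ_n a_n cos(y log n) ≥ 0` for all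
real `y`. Then `-Re F(0) ≤ Re W_ar(F)` for every `F = Σᵢ gᵢ ⋆ g̃ᵢ` (Weil tests `gᵢ`, ANY support)
that is node-nonnegative and whose far-field negativity lies in the window. [folklore] -/
theorem neg_re_apply_zero_le_re_weilArchPolar_of_erasure
    {k : ℕ} {g : Fin k → ℝ → ℂ} {F : ℝ → ℂ} (hF : F = fun t => ∑ i, weilConv (g i) (weilReflect (g i)) t)
    (hg : ∀ i, IsWeilTest (g i)) (hn : ∀ n : ℕ, 2 ≤ n → 0 ≤ (F (Real.log n)).re)
    (hw : ∀ t : ℝ, Real.log 2 ≤ |t| → (F t).re < 0 → T ≤ |t| ∧ |t| ≤ T + Real.log 2) :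
    -(F 0).re ≤ (weilPolarTerm F + weilArchTerm F).re := by
  -- notation
  set P : ℝ → ℝ := fun x => Real.exp (x / 2) + Real.exp (-(x / 2)) with hP
  have hGi : ∀ i, IsWeilTest (weilConv (g i) (weilReflect (g i))) := fun i =>
    (hg i).weilConv (hg i).weilReflect
  -- hermitian symmetry of `F`
  have hsym : ∀ t : ℝ, conj (F (-t)) = F t := by
    intro t
    simp only [hF, map_sum, conj_weilConv_weilReflect_neg]
  have hre_neg : ∀ t : ℝ, (F (-t)).re = (F t).re := fun t => by
    rw [← hsym t, Complex.conj_re]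
  -- `W_ar` and `F(0)` over the sum
  have hA : weilPolarTerm F + weilArchTerm F =
      ∑ i, (weilPolarTerm (weilConv (g i) (weilReflect (g i))) +
        weilArchTerm (weilConv (g i) (weilReflect (g i)))) := by
    rw [hF]
    exact weilArchPolar_finset_sum _ fun i _ => hGi i
  have h0 : (F 0).re = ∑ i, weilNorm2Sq (g i) := re_apply_zero_eq_sum_weilNorm2Sq hF
  -- the node terms, summed over `i`, are `Σ_n (a_n/2) · 2 Re F(log n) ≥ 0`
  have hNsum : ∑ i, (∑ n ∈ nodes, ((a n / 2 : ℝ) : ℂ) *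
      (weilConv (g i) (weilReflect (g i)) (Real.log n) +
        weilConv (g i) (weilReflect (g i)) (-Real.log n))).re =
      ∑ n ∈ nodes, a n / 2 * ((F (Real.log n)).re + (F (-Real.log n)).re) := by
    rw [← Complex.re_sum, Finset.sum_comm]
    rw [Complex.re_sum]
    refine Finset.sum_congr rfl fun n _ => ?_
    rw [← Finset.mul_sum, Complex.re_ofReal_mul, Complex.re_sum]
    congr 1
    rw [hF]
    simp only [Complex.add_re, Complex.re_sum, Finset.sum_add_distrib]
  have hNnonneg : 0 ≤ ∑ n ∈ nodes, a n / 2 * ((F (Real.log n)).re + (F (-Real.log n)).re) := by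
    refine Finset.sum_nonneg fun n hn' => mul_nonneg (by linarith [ha n hn']) ?_
    rw [hre_neg]
    have := hn n (hnodes n hn')
    linarith
  -- the erased remainders, summed over `i`, are `∫ Re F · (P − E) ≥ 0`
  have hRi : ∀ i, Integrable fun x : ℝ =>
      (weilConv (g i) (weilReflect (g i)) x).re * (P x - E x) := by
    intro i
    have hc : Continuous fun x : ℝ => (weilConv (g i) (weilReflect (g i)) x).re :=
      Complex.continuous_re.comp (hGi i).1.continuous
    refine (hc.mul (by rw [hP]; fun_prop)).integrable_of_hasCompactSupport ?_
    exact ((hGi i).2.comp_left Complex.zero_re).mul_right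
  have hRsum : ∑ i, ∫ x : ℝ, (weilConv (g i) (weilReflect (g i)) x).re * (P x - E x) =
      ∫ x : ℝ, (F x).re * (P x - E x) := by
    rw [← integral_finsetSum _ fun i _ => hRi i]
    congr 1 with x
    rw [hF]
    simp only [Complex.re_sum, Finset.sum_mul]
  have hRnonneg : 0 ≤ ∫ x : ℝ, (F x).re * (P x - E x) := by
    refine integral_nonneg fun x => ?_
    show (0 : ℝ) ≤ (F x).re * (P x - E x)
    by_cases hx : |x| < Real.log 2 ∨ (T ≤ |x| ∧ |x| ≤ T + Real.log 2)
    · have hPx : P x - E x = 0 := by rw [hP, hEeq x hx]; ring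
      rw [hPx, mul_zero]
    · have hPE : 0 ≤ P x - E x := by simp only [hP]; linarith [hEle x]
      have hFx : 0 ≤ (F x).re := by
        by_contra hneg
        push Not at hneg hx
        exact absurd (hw x hx.1 hneg) (fun hwin => (hx.2 hwin.1).not_ge hwin.2)
      exact mul_nonneg hFx hPE
  -- the per-test inequalities, summed
  have hsum : -(∑ i, weilNorm2Sq (g i)) ≤
      ∑ i, ((weilPolarTerm (weilConv (g i) (weilReflect (g i))) +
          weilArchTerm (weilConv (g i) (weilReflect (g i))) -
        ∑ n ∈ nodes, ((a n / 2 : ℝ) : ℂ) *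
          (weilConv (g i) (weilReflect (g i)) (Real.log n) +
            weilConv (g i) (weilReflect (g i)) (-Real.log n))).re -
        ∫ x : ℝ, (weilConv (g i) (weilReflect (g i)) x).re * (P x - E x)) := by
    rw [← Finset.sum_neg_distrib]
    refine Finset.sum_le_sum fun i _ => ?_
    have h := neg_slack_le_sub_erasure_of_density_nonneg (hg i) hEc hEs 1 nodes a hD
    rw [one_mul] at h
    exact h
  have key : ∑ i, ((weilPolarTerm (weilConv (g i) (weilReflect (g i))) +
          weilArchTerm (weilConv (g i) (weilReflect (g i))) -
        ∑ n ∈ nodes, ((a n / 2 : ℝ) : ℂ) *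
          (weilConv (g i) (weilReflect (g i)) (Real.log n) +
            weilConv (g i) (weilReflect (g i)) (-Real.log n))).re -
        ∫ x : ℝ, (weilConv (g i) (weilReflect (g i)) x).re * (P x - E x)) =
      (weilPolarTerm F + weilArchTerm F).re -
        ∑ n ∈ nodes, a n / 2 * ((F (Real.log n)).re + (F (-Real.log n)).re) -
        ∫ x : ℝ, (F x).re * (P x - E x) := by
    rw [Finset.sum_sub_distrib, hRsum, ← hNsum, hA, Complex.re_sum, ← Finset.sum_sub_distrib]
    refine congrArg (· - _) (Finset.sum_congr rfl fun i _ => ?_)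
    rw [Complex.sub_re]
  rw [h0]
  rw [key] at hsum
  linarith

/-- **`OscSingleWindow` at the window `T`, from an erasure certificate at `T`** — the crux
stmt-RiemannHypothesis-18012 with its window parameter fixed to `T` (body verbatim over Mathlib
primitives, every cutoff `a`): kernel `E ≤ e^{x/2}+e^{-x/2}` with equality on `|x| < log 2` and on
`T ≤ |x| ≤ T + log 2`, weights `a_n ≥ 0` on nodes `n ≥ 2`, and the pointwise density inequality
`0 ≤ Re ψ(1/4+iy/2) − log π + 1 + Ê(y) − Σ_n a_n cos(y log n)`. [folklore] -/
theorem oscSingleWindowAt_of_erasure :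
    ∀ a : ℝ, 0 < a → ∀ (k : ℕ) (g : Fin k → ℝ → ℂ), (∀ i, (ContDiff ℝ ((⊤ : ℕ∞) : WithTop ℕ∞) (g i) ∧ HasCompactSupport (g i)) ∧ tsupport (g i) ⊆ Set.Icc (-a) a) → let F : ℝ → ℂ := fun t => ∑ i, MeasureTheory.convolution (g i) (fun u => (starRingEnd ℂ) ((g i) (-u))) (ContinuousLinearMap.mul ℂ ℂ) MeasureTheory.MeasureSpace.volume t; (∀ n : ℕ, 2 ≤ n → 0 ≤ (F (Real.log n)).re) → (∀ t : ℝ, Real.log 2 ≤ |t| → (F t).re < 0 → T ≤ |t| ∧ |t| ≤ T + Real.log 2) → (∃ t : ℝ, Real.log 2 ≤ |t| ∧ (F t).re < 0) → let M : ℂ → ℂ := fun s => ∫ u : ℝ, F u * Complex.exp ((s - 1 / 2) * u); -(F 0).re ≤ (M 0 + M 1 + ((1 / (2 * Real.pi) : ℂ) * (∫ t : ℝ, M (1 / 2 + t * Complex.I) * ((Complex.digamma (1 / 4 + t / 2 * Complex.I)).re : ℂ)) - F 0 * (Real.log Real.pi : ℂ))).re := by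
  intro b _hb k g hg F hn hw _hosc M
  exact neg_re_apply_zero_le_re_weilArchPolar_of_erasure hEc hEs hEle hEeq nodes hnodes a ha hD
    (g := g) (F := F) rfl (fun i => (hg i).1) hn hw

end Class

end Summit.RiemannHypothesis.RiemannHypothesis.Theorems.SignCone

end
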